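import Literature.AlgebraicGeometry.HodgeTheory.BlochSemiregularityMapReal
import HarnessLib

/-!
# Bloch semiregularity: the vacuous codimensions and the criterion «target of the pairing map vanishes»
# (Bloch 1972 §0–§1; Buchweitz–Flenner 2003 §1, (8.1) (2)) — complements to `HodgeTheory.IsBlochSemiregular`

Layer `Literature/AlgebraicGeometry/HodgeTheory` (literature-typing tranche LT-H1 «semiregularity consumers», cell `pub-hsemireg`,
width seat lit-4 g6; third file). PLAIN on the tree's `BlochSemiregularityMapReal.lean`; everything PROVED; no definition, no named
fact, no `instance`, no notation (net debt 0).

`HodgeTheory.IsBlochSemiregular i n p` (real carriers) says: for `r + 1 = p`, `m + p = n`, `k + 1 = m` the Bloch pairing map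
`blochPairingMap i r (m+1) k : H^{m-1}(X, Ω^{m+1}_X) → H^{m-1}(X, 𝓐lt_{p-1}(𝓘; Ωⁿ_X|_Z))` is SURJECTIVE — by [BuchweitzFlenner2003,
(8.1) (2)] the transpose of Bloch's `π : H¹(Z, 𝒩_{Z∕X}) → H^{p+1}(X, Ω^{p-1}_X)`, whose injectivity is semiregularity
([Bloch1972Semiregularity, §0 p. 51 l. 8–9] «`Z` is said to be semi-regular if `π` is injective»). This file records the cases in which
the definition holds for trivial reasons, in the form consumers can invoke:

* `isBlochSemiregular_zero` — codimension `p = 0` (no `r` with `r + 1 = 0`); `isBlochSemiregular_of_lt` — `p > n` (no `m` with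
  `m + p = n`); together with the tree's `isBlochSemiregular_of_eq` (`p = n`, `dim Z = 0`) these are the «degenerate cases (`p = 0`,
  `p > n`, `dim Z = 0`) vacuously semiregular» announced in the docstring of `IsBlochSemiregular`.
* **`isBlochSemiregular_of_subsingleton_target`** — if the TARGET group `H^{m-1}(X, 𝓐lt_{p-1}(𝓘; Ωⁿ_X|_Z))` of the pairing map
  vanishes, `Z` is Bloch-semiregular (a map onto a zero group is onto). This is the reading, on the tree's (Serre-dual) carrier
  `H^{m-1}(Z, Λ^{p-1}𝒩 ⊗ ω_X|_Z) ≅ H^{m-1}(Z, 𝒩^∨ ⊗ ω_Z) = H¹(Z, 𝒩)^∨`, of the classical remark that `H¹(Z, 𝒩_{Z∕X}) = 0` makes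
  `Z` semiregular trivially (`π` is then injective for want of a source): [BuchweitzFlenner2003, §1] «if `Z` is locally a complete
  intersection in `X` then the vanishing of `H¹(Z, 𝒩_{Z∕X})` implies that `[Z]` is a smooth point of `H_X`. It was, however, already
  observed by Severi that the converse is not true in general. He introduced the notion of a semiregular curve …»;
  [Bloch1972Semiregularity, p. 53 l. 7–8] «I have two examples of semi-regularity in codimension `> 1` with `H¹(Z, N_{Z∕X}) ≠ (0)`»
  and (1.2) (ii) «Suppose `Z` is smooth of codimension `≥ 1` and `H¹(Z, N_{Z∕X}) = (0)`. Then `Z ∈ Hilb(X∕C)` is smooth.»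
* `isBlochSemiregular_one_of_subsingleton_formsOnSubscheme` (`p = 1`: `H^{n-2}(X, Ωⁿ_X|_Z) = 0`, via `isBlochSemiregular_one_iff`) and
  `isBlochSemiregular_two_of_subsingleton_pairingTarget` (`p = 2`, the route's surfaces in fourfolds: `H^{m-1}(X, 𝓗om(𝓘, Ω^{m+2}_X|_Z))
  = H^{m-1}(Z, 𝒩 ⊗ ω_X|_Z) = 0` — for `n = 4`, `H¹(W, 𝒩_W ⊗ K_X|_W) = 0`, i.e. `H¹(W, 𝒩_W) = 0` when `K_X` is trivial — via
  `isBlochSemiregular_two_iff`).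
* `IsBlochSemiregular.surjective` ∕ `isBlochSemiregular_of_surjective` — the definition at given `(r, m, k)`, both directions, as
  plain implications (the tree has the `iff`).

HONEST SCOPE: no Serre duality is constructed; «target = 0» is equivalent to «`H¹(Z, 𝒩) = 0`» only under that duality (for `Z` a
local complete intersection in `X` smooth proper), which is the printed MEANING, not a theorem here. `X` any `S`-scheme, `i` any
morphism (the definitions need no hypothesis). Grade REFEREED (Invent. Math. 17; Compositio 137).

## References

* [Bloch1972Semiregularity] S. Bloch, *Semi-regularity and de Rham cohomology*, Invent. Math. 17 (1972) 51–66: §0 p. 51 l. 8–9, §1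
  p. 52 (definition of `π`), p. 53 l. 7–8 and (1.2) (ii) (GDZ page images held by the cell, `HOME/lit/Bloch1972-Invent17-GDZ`;
  transcription `HOME/lit/Bloch1972.md` §1–§3).
* [BuchweitzFlenner2003] R.-O. Buchweitz, H. Flenner, *A semiregularity map for modules and applications to deformations*,
  Compositio Math. 137 (2003) 135–210: §1 (held `paper:arxiv-math_9912245` p. 3 l. 9–14), (8.1) (2).

## Design notes

* Reused by name: `IsBlochSemiregular`, `isBlochSemiregular_iff`, `isBlochSemiregular_one_iff`, `isBlochSemiregular_two_iff`,
  `blochPairingMap`, `blochPairingMapMultiHom`, `altMultiHom`, `idealModule`, `formsOnSubscheme`, `pairingDegree`, `pairingTarget`,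
  `restrictForms`, `moduleSheafCohomology` (all `HodgeTheory/BlochSemiregularityMapReal` ∕ `TwistedSemiregularityMap`). Nothing restated:
  `lean search` finds only `isBlochSemiregular_of_eq` among the degenerate cases.
-/

noncomputable section

open CategoryTheory AlgebraicGeometry Opposite TopologicalSpace

universe u

namespace Literature.AlgebraicGeometry.HodgeTheory

open Literature.AlgebraicGeometry.Modules Literature.AlgebraicGeometry.Motives Literature.AlgebraicGeometry.Deformation

variable {S : Type u} [CommRing S] {X : Over (Spec (CommRingCat.of S))} {Z : Scheme.{u}} (i : Z ⟶ X.left)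

/-! ## §1 The vacuous codimensions -/

/-- **Codimension `0` is vacuously Bloch-semiregular** (there is no `r` with `r + 1 = 0`: the pairing needs `p - 1 ≥ 0` conormal
slots) — one of the degenerate cases listed with `IsBlochSemiregular`.
[cite: BuchweitzFlenner2003, (8.1) (2) (reading: the definition quantifies over r + 1 = p)] -/
theorem isBlochSemiregular_zero (n : ℕ) : IsBlochSemiregular i n 0 :=
  fun _ _ _ hp _ _ => absurd hp (Nat.succ_ne_zero _)

/-- **Codimension `p > n = dim X` is vacuously Bloch-semiregular** (there is no `m` with `m + p = n`).
[cite: BuchweitzFlenner2003, (8.1) (2) (reading: the definition quantifies over m + p = n)] -/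
theorem isBlochSemiregular_of_lt {n p : ℕ} (h : n < p) : IsBlochSemiregular i n p :=
  fun _ _ _ _ hn _ => by omega

/-! ## §2 The definition as implications at given indices -/

variable {i} in
/-- A Bloch-semiregular `Z` has surjective pairing map `H^{m-1}(X, Ω^{m+1}_X) → H^{m-1}(X, 𝓐lt_{p-1}(𝓘; Ωⁿ_X|_Z))` at any admissible
indices `r + 1 = p`, `m + p = n`, `k + 1 = m`. [cite: BuchweitzFlenner2003, (8.1) (2)]
[cite: Bloch1972Semiregularity, §0 p. 51 l. 8–9 («Z is said to be semi-regular if π is injective»; reading: the transposed map)] -/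
theorem IsBlochSemiregular.surjective {n p r m k : ℕ} (h : IsBlochSemiregular i n p) (hp : r + 1 = p) (hn : m + p = n)
    (hk : k + 1 = m) : Function.Surjective (blochPairingMap i r (m + 1) k) :=
  h r m k hp hn hk

/-- Surjectivity of the pairing map at ONE admissible triple of indices is Bloch semiregularity (the indices are determined by
`n` and `p`). [cite: BuchweitzFlenner2003, (8.1) (2)] -/
theorem isBlochSemiregular_of_surjective {n p r m k : ℕ} (hp : r + 1 = p) (hn : m + p = n) (hk : k + 1 = m)
    (h : Function.Surjective (blochPairingMap i r (m + 1) k)) : IsBlochSemiregular i n p :=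
  (isBlochSemiregular_iff hp hn hk).mpr h

/-! ## §3 «`H¹(Z, 𝒩) = 0` ⇒ semiregular», on the tree's (dual) carrier: the target of the pairing map vanishes -/

/-- **If the target `H^{m-1}(X, 𝓐lt_{p-1}(𝓘; Ωⁿ_X|_Z))` of Bloch's pairing map vanishes, `Z` is Bloch-semiregular** (a homomorphism
onto a zero group is surjective). On the printed side this is the remark that `H¹(Z, 𝒩_{Z∕X}) = 0` gives semiregularity for free
(`π : H¹(Z, 𝒩) → H^{p+1}(X, Ω^{p-1})` injective for want of a source) — the target here being, by Serre duality on `Z`, the dual of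
`H¹(Z, 𝒩)` ([BuchweitzFlenner2003, (8.1) (2)]); [BuchweitzFlenner2003, §1]: «the vanishing of `H¹(Z, 𝒩_{Z/X})` implies that `[Z]` is a
smooth point of `H_X`. It was, however, already observed by Severi that the converse is not true»; [Bloch1972Semiregularity, p. 53]:
«I have two examples of semi-regularity in codimension `> 1` with `H¹(Z, N_{Z/X}) ≠ (0)`», (1.2) (ii).
[cite: BuchweitzFlenner2003, §1 and (8.1) (2) (reading: target of the transposed map = dual of H¹(Z, 𝒩))]
[cite: Bloch1972Semiregularity, p. 53 l. 7–8 and (1.2) (ii)] -/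
theorem isBlochSemiregular_of_subsingleton_target {n p r m k : ℕ} (hp : r + 1 = p) (hn : m + p = n) (hk : k + 1 = m)
    [Subsingleton (moduleSheafCohomology
      (altMultiHom (idealModule i) (formsOnSubscheme i (pairingDegree r (m + 1))) r) k)] :
    IsBlochSemiregular i n p :=
  isBlochSemiregular_of_surjective i hp hn hk fun _ => ⟨0, Subsingleton.elim _ _⟩

/-- **Codimension one**: if `H^{n-2}(X, Ωⁿ_X|_Z) = H^{n-2}(X, i_*i^*Ωⁿ_X) = 0` (`n = m + 1 = k + 2`) then the hypersurface `Z` is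
Bloch-semiregular (the restriction `H^{n-2}(X, Ωⁿ_X) → H^{n-2}(X, Ωⁿ_X|_Z)` of `isBlochSemiregular_one_iff` lands in a zero group).
[cite: BuchweitzFlenner2003, §1 (Severi's definition; reading: zero target)] -/
theorem isBlochSemiregular_one_of_subsingleton_formsOnSubscheme {n m k : ℕ} (hn : m + 1 = n) (hk : k + 1 = m)
    [Subsingleton (moduleSheafCohomology (formsOnSubscheme i (m + 1)) k)] : IsBlochSemiregular i n 1 :=
  (isBlochSemiregular_one_iff i hn hk).mpr fun _ => ⟨0, Subsingleton.elim _ _⟩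

/-- **Codimension two** (surfaces in fourfolds when `n = 4`): if
`H^{m-1}(X, 𝓗om(𝓘, Ω^{m+2}_X|_Z)) = H^{m-1}(Z, 𝒩 ⊗ ω_X|_Z) = 0` (`n = m + 2`, `m = k + 1`; for `n = 4`: `H¹(W, 𝒩_W ⊗ K_X|_W) = 0`,
which is `H¹(W, 𝒩_W) = 0` when `K_X` is trivial) then `Z` is Bloch-semiregular — the codimension-`2` instance of «`H¹(Z, 𝒩) = 0` ⇒
semiregular» on the tree's carrier (`isBlochSemiregular_two_iff`). [cite: BuchweitzFlenner2003, (8.1) (1)-(2) (reading: zero target)]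
[cite: Bloch1972Semiregularity, (1.2) (ii) p. 53 (H¹(Z, N) = 0 ⇒ [Z] smooth; reading)] -/
theorem isBlochSemiregular_two_of_subsingleton_pairingTarget {n m k : ℕ} (hn : m + 2 = n) (hk : k + 1 = m)
    [Subsingleton (moduleSheafCohomology (pairingTarget i 1 (m + 1)) k)] : IsBlochSemiregular i n 2 :=
  (isBlochSemiregular_two_iff i hn hk).mpr fun _ => ⟨0, Subsingleton.elim _ _⟩

end Literature.AlgebraicGeometry.HodgeTheory

end
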